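import Mathlib.RingTheory.Invariant.Profinite
import Mathlib.FieldTheory.Galois.Infinite
import Mathlib.FieldTheory.Perfect
import Literature.NumberTheory.GaloisRepresentations.IntegralGaloisAction
import HarnessLib

/-!
# Discharges of named facts in `IntegralGaloisAction.lean`: Frobenius elements and transitivity
in `Gal(K̄/K)`; ideal- versus valuation-indexed decomposition groups (trunk GalRep, item C3)

D-0014 keeps `Literature/` sorry-free by stating cited results as named facts `def X : Prop`.
This sibling file proves the named facts of
`Literature.NumberTheory.GaloisRepresentations.IntegralGaloisAction` about the primes `𝔓` of
`\bar ℤ_K = Literature.absIntegers (𝓞 K) K` above a finite place `v` of a number field `K`, as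
`theorem X_holds : X` (users holding `(h : X)` are fed `X_holds`):

* `IsDedekindDomain.HeightOneSpectrum.exists_isArithFrobAt_of_mem_primesAbove_holds` —
  every `𝔓 ∣ v` admits an arithmetic Frobenius `σ ∈ Gal(K̄/K)`, `σ • x ≡ x ^ {N v} (mod 𝔓)`;
* `IsDedekindDomain.HeightOneSpectrum.exists_smul_eq_of_mem_primesAbove_holds` — `Gal(K̄/K)`
  acts transitively on the primes above `v`;
* `IsDedekindDomain.HeightOneSpectrum.exists_isArithFrobAt_conj_of_mem_primesAbove_holds` —
  Frobenius elements above `v` are conjugate (its interim proof, preserved as a comment in the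
  parent file, used only the transitivity fact and Mathlib's `IsArithFrobAt.conj`);

and the comparison theorem of the parent file's section
"Comparison with `ValuationSubring.decompositionSubgroup`":

* `Ideal.decompositionSubgroup_eq_of_valuationSubring_holds` — for `R` Dedekind with fraction
  field `K`, `L/K` algebraic, `S = integralClosure R L ⊆ A` a valuation subring of `L` and
  `𝔓 = 𝔪_A ∩ S`, the stabiliser of `𝔓` in `L ≃ₐ[K] L` is Mathlib's
  `ValuationSubring.decompositionSubgroup K A` (last section of this file, which needs no import
  beyond the parent module).

The extra imports (`Mathlib.RingTheory.Invariant.Profinite`, which pulls in the category of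
profinite groups, and `Mathlib.FieldTheory.Galois.Infinite`) are the reason for a sibling file
rather than an append to the parent module.

## Proof architecture (Frobenius elements and transitivity)

Neukirch (*Algebraic Number Theory*, Ch. I §9) proves both statements for a *finite* Galois
extension `L|K` of the fraction field of a Dedekind (indeed any integrally closed) domain:
Prop. (9.1) — `G(L|K)` acts transitively on the primes `𝔓 ∣ 𝔭`; Prop. (9.4) — the
decomposition group surjects onto `G(κ(𝔓)|κ(𝔭))`; hence (Def. (9.5) and Exercise 2, p. 58) for a
finite residue field `κ(𝔭)` with `q` elements there is a Frobenius automorphism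
`φ_𝔓 ∈ G_𝔓`, `φ_𝔓 a ≡ a ^ q mod 𝔓`.  The passage to `K̄ = ⋃ L` (Serre, *Abelian ℓ-adic
representations*, Ch. I §2.1) is a compactness argument over the finite Galois subextensions.
Mathlib has carried out precisely this limit argument for a profinite group `G` acting
continuously on a discrete ring `B` with ring of invariants `A` (`Algebra.IsInvariant A B G`):
`Algebra.IsInvariant.exists_smul_of_under_eq_of_profinite` (transitivity) and
`Ideal.Quotient.stabilizerHom_surjective_of_profinite` (`G_𝔓 ↠ Aut((B⧸𝔓)/(A⧸𝔭))`), both in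
`Mathlib/RingTheory/Invariant/Profinite.lean`.  We therefore only have to place
`G = Gal(K̄/K)`, `A = R` (`= 𝓞 K`), `B = absIntegers R K` in this setting:

1. `Literature.NumberTheory.GaloisRepresentations.absIntegers.isOpen_stabilizer`: stabilisers of elements of `\bar ℤ` are open in the
   Krull topology (parent file, `Literature.NumberTheory.GaloisRepresentations.stabilizer_integralClosure_isOpen`), hence the action is
   continuous for the discrete topology on `\bar ℤ` (`Literature.NumberTheory.GaloisRepresentations.absIntegers.continuousSMul`,
   Mathlib `continuousSMul_iff_stabilizer_isOpen`);
2. `Literature.NumberTheory.GaloisRepresentations.absIntegers.isInvariant`: `\bar ℤ ^ {Gal(K̄/K)} = R` for `R` integrally closed with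
   fraction field `K` of characteristic `0` (`K̄ ^ {Gal(K̄/K)} = K` by infinite Galois theory,
   Mathlib `InfiniteGalois.mem_bot_iff_fixed`, and `K ∩ \bar ℤ = R`,
   `IsIntegrallyClosed.algebraMap_eq_of_integral`);
3. `Literature.NumberTheory.GaloisRepresentations.exists_isArithFrobAt_of_isInvariant_of_profinite`: the profinite analogue of Mathlib's
   `IsArithFrobAt.exists_of_isInvariant` (stated there for finite `G`): the residue field
   `B ⧸ Q` is perfect (algebraic over the finite field `A ⧸ 𝔭`), so `x ↦ x ^ q` is an
   `A ⧸ 𝔭`-automorphism of it, which lifts to some `σ ∈ G_Q` by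
   `stabilizerHom_surjective_of_profinite`; that `σ` is an arithmetic Frobenius at `Q`.

## Proof architecture (`Ideal.decompositionSubgroup_eq_of_valuationSubring`)

Serre (*Local Fields*, Ch. I §7, after Prop. 19) defines the decomposition group of a prime `𝔓`
of the integral closure `B` as its stabiliser and identifies it (Ch. II §3, Cor. 4 to Thm. 1)
with "the decomposition group of `w`", `w` the valuation attached to `𝔓`, because for a Dedekind
domain the non-zero primes and the valuation rings of the fraction field containing it
correspond via `𝔓 ↦ B_𝔓` (Ch. I §3, Prop. 4: `B_𝔓` is a discrete valuation ring; Ch. I §4,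
Prop. 8–9: `B` is Dedekind for `L/K` finite separable).  For `L/K` merely algebraic the same
holds because `S = integralClosure R L` is the union of the Dedekind rings of integers of the
finite separable subextensions (Zariski–Samuel, *Commutative Algebra* II, Ch. VI §7, Thm. 12: a
valuation ring of an algebraic extension is the localisation of the integral closure at its
centre).  Concretely (`Ideal.exists_mul_eq_of_mem_valuationSubring`): every `x ∈ A` is `s / t`
with `s ∈ S`, `t ∈ S ∖ 𝔓` — pass to a power `y = x ^ (q ^ n)` separable over `K`
(`Irreducible.hasSeparableContraction`), so that `K(y)/K` is finite separable and
`S' = integralClosure R K(y)` is Dedekind (Mathlib `integralClosure.isDedekindDomain`) with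
`S'_{𝔓 ∩ S'}` a DVR (`IsLocalization.AtPrime.isDiscreteValuationRing_of_dedekind_domain`), hence
a valuation ring of `K(y)`; so `y = s / t` or `y * s = t` with `s ∈ 𝔓`, `t ∉ 𝔓`
(`Ideal.exists_mul_algebraMap_eq_or_of_isDedekindDomain`), and the second case contradicts
`y ∈ A`; finally `(x t) ^ (q ^ n) = s t ^ (q ^ n - 1) ∈ S` forces `x t ∈ S`.  Hence
`σ • 𝔓 = 𝔓` implies `σ • A ⊆ A` (`σ t ∈ S ∖ 𝔓 ⊆ Aˣ`), and with `σ⁻¹` equality; the inclusion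
`D_A ≤ D_𝔓` is the parent file's `Ideal.decompositionSubgroup_valuationSubring_le`.

## References

* J. Neukirch, *Algebraic Number Theory*, Grundlehren 322, Springer 1999, Ch. I §9:
  Prop. (9.1) (transitivity), Prop. (9.4), Def. (9.5) and Exercise 2, p. 58 (Frobenius
  automorphism). [NeukirchANT1999]
* J.-P. Serre, *Abelian ℓ-adic representations and elliptic curves*, Benjamin 1968, Ch. I §2.1
  (Frobenius elements in `Gal(K̄/K)`). [SerreAbelianLadic1968]
* J.-P. Serre, *Local Fields*, GTM 67, Springer 1979, Ch. I §3 Prop. 4, §4 Prop. 8–9, §7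
  Prop. 19–21 (decomposition group `D_𝔓`); Ch. II §3, Cor. 4 to Thm. 1 (decomposition group of
  the valuation `w_i`). [SerreLocalFields1979]
* O. Zariski, P. Samuel, *Commutative Algebra* II, GTM 29, Springer 1960, Ch. VI §7, Thm. 12
  (valuation rings of an algebraic extension are localisations of the integral closure).
  [ZariskiSamuel1960]
-/

noncomputable section

open scoped Pointwise NumberField

namespace Literature.NumberTheory.GaloisRepresentations

/-! ### Frobenius elements for profinite invariant actions -/

section ProfiniteFrob

variable {A B : Type*} [CommRing A] [CommRing B] [Algebra A B]
variable {G : Type*} [Group G] [MulSemiringAction G B] [SMulCommClass G A B]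
variable [TopologicalSpace G] [CompactSpace G] [TotallyDisconnectedSpace G]
variable [IsTopologicalGroup G] [TopologicalSpace B] [DiscreteTopology B] [ContinuousSMul G B]

/-- **Existence of Frobenius elements (profinite invariant actions).**  Let the profinite group
`G` act continuously on the discrete `A`-algebra `B` with `B ^ G = A`
(`Algebra.IsInvariant A B G`), and let `Q` be a maximal ideal of `B` whose residue ring
`A ⧸ (Q ∩ A)` downstairs is finite, of cardinality `q`.  Then some `σ ∈ G` is an arithmetic
Frobenius at `Q` (Mathlib `IsArithFrobAt A σ Q`: `σ • x ≡ x ^ q (mod Q)` for all `x`).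
This is the profinite analogue of Mathlib's `IsArithFrobAt.exists_of_isInvariant` (finite `G`):
`B ⧸ Q` is a perfect field (algebraic over the finite field `A ⧸ (Q ∩ A)`, `B` being integral
over `A` by `Algebra.IsInvariant.isIntegral_of_profinite`), so `x ↦ x ^ q` is an
`A ⧸ (Q ∩ A)`-algebra automorphism of `B ⧸ Q`, and it lifts to the decomposition group of `Q`
by `Ideal.Quotient.stabilizerHom_surjective_of_profinite`.
Ref: Neukirch, *Algebraic Number Theory*, Ch. I §9, Prop. (9.4), Def. (9.5) and Exercise 2,
p. 58 (finite level); Serre, *Abelian ℓ-adic representations* (1968), Ch. I §2.1 (limit).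
[cite: NeukirchANT1999, Ch. I §9 Prop. (9.4) and Exercise 2 (p. 58)] -/
theorem exists_isArithFrobAt_of_isInvariant_of_profinite [Algebra.IsInvariant A B G]
    (Q : Ideal B) [Q.IsMaximal] [Finite (A ⧸ Q.under A)] : ∃ σ : G, IsArithFrobAt A σ Q := by
  -- the residue rings of the maximal ideals `Q` and `P = Q ∩ A` are fields (`Ideal.Quotient.field`
  -- is a `def` in Mathlib, to be introduced locally, cf. `IsArithFrobAt.exists_of_isInvariant`)
  letI := Ideal.Quotient.field Q
  let P := Q.under A
  have := Algebra.IsInvariant.isIntegral_of_profinite (A := A) (B := B) (G := G)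
  have hPmax : P.IsMaximal := Ideal.IsMaximal.under A Q
  letI := Ideal.Quotient.field P
  obtain ⟨p, hc⟩ := CharP.exists (A ⧸ P)
  cases nonempty_fintype (A ⧸ P)
  obtain ⟨k, hp, hk⟩ := FiniteField.card (A ⧸ P) p
  have := CharP.of_ringHom_of_ne_zero (algebraMap (A ⧸ P) (B ⧸ Q)) p hp.ne_zero
  have : ExpChar (B ⧸ Q) p := .prime hp
  have : Algebra.IsAlgebraic (A ⧸ P) (B ⧸ Q) := Algebra.IsIntegral.isAlgebraic
  have : PerfectField (B ⧸ Q) := Algebra.IsAlgebraic.perfectField (A ⧸ P)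
  -- the `q`-power map, `q = p ^ k = #(A ⧸ P)`, as an `A ⧸ P`-algebra automorphism of `B ⧸ Q`
  let l : (B ⧸ Q) ≃ₐ[A ⧸ P] B ⧸ Q :=
    { __ := iterateFrobeniusEquiv (B ⧸ Q) p k,
      commutes' r := by
        dsimp [iterateFrobenius_def]
        rw [← map_pow, ← hk, FiniteField.pow_card] }
  obtain ⟨σ, hσ⟩ := Ideal.Quotient.stabilizerHom_surjective_of_profinite (G := G) P Q l
  refine ⟨σ, fun x ↦ ?_⟩
  rw [← Ideal.Quotient.eq, Nat.card_eq_fintype_card, hk]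
  exact DFunLike.congr_fun hσ (Ideal.Quotient.mk Q x)

end ProfiniteFrob

/-! ### `Gal(K̄/K)` acting on `absIntegers R K`: continuity and invariants -/

section AbsIntegersProfinite

open Field

variable (R : Type*) {K : Type*} [CommRing R] [Field K] [Algebra R K]

/-- The stabiliser in `Gal(K̄/K)` of an element of `\bar ℤ = absIntegers R K` is open for the
Krull topology (the case `L = K̄` of `Literature.NumberTheory.GaloisRepresentations.stabilizer_integralClosure_isOpen`; the group, its
action and its topology are transported verbatim from `K̄ ≃ₐ[K] K̄`).
Ref: Neukirch, *Algebraic Number Theory*, Ch. IV §1, (1.2). [folklore] -/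
theorem absIntegers.isOpen_stabilizer (x : absIntegers R K) :
    IsOpen (MulAction.stabilizer (absoluteGaloisGroup K) x : Set (absoluteGaloisGroup K)) :=
  Literature.NumberTheory.GaloisRepresentations.stabilizer_integralClosure_isOpen R (K := K) (L := AlgebraicClosure K) x

/-- For the discrete topology on `\bar ℤ = absIntegers R K`, the action of the profinite group
`Gal(K̄/K)` is (jointly) continuous: all stabilisers are open
(Mathlib `continuousSMul_iff_stabilizer_isOpen`).
Ref: Serre, *Abelian ℓ-adic representations* (1968), Ch. I §2.1; Neukirch, *Algebraic Number
Theory*, Ch. IV §1. [folklore] -/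
theorem absIntegers.continuousSMul [TopologicalSpace (absIntegers R K)]
    [DiscreteTopology (absIntegers R K)] :
    ContinuousSMul (absoluteGaloisGroup K) (absIntegers R K) :=
  continuousSMul_iff_stabilizer_isOpen.mpr (absIntegers.isOpen_stabilizer R)

/-- **`\bar ℤ ^ {Gal(K̄/K)} = R`.**  If `R` is an integrally closed domain with fraction field
`K` of characteristic `0`, the elements of `absIntegers R K` fixed by all of `Gal(K̄/K)` are
exactly the image of `R` (Mathlib `Algebra.IsInvariant`): a fixed element lies in `K`
(`K̄ / K` is Galois, `InfiniteGalois.mem_bot_iff_fixed`) and is integral over `R`.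
Ref: Neukirch, *Algebraic Number Theory*, Ch. I §9 (setting of Hilbert's ramification theory,
`A = 𝒪 ∩ K` integrally closed) and Ch. IV §1. [folklore] -/
theorem absIntegers.isInvariant [IsDomain R] [IsFractionRing R K] [IsIntegrallyClosed R]
    [CharZero K] : Algebra.IsInvariant R (absIntegers R K) (absoluteGaloisGroup K) := by
  refine ⟨fun b hb ↦ ?_⟩
  have hb' : (b : AlgebraicClosure K) ∈ (⊥ : IntermediateField K (AlgebraicClosure K)) := by
    rw [InfiniteGalois.mem_bot_iff_fixed]
    intro f
    have := congrArg Subtype.val (hb ((absoluteGaloisGroup.toAlgEquiv K).symm f))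
    rwa [integralClosure.coe_smul, absoluteGaloisGroup.toAlgEquiv_symm_apply] at this
  obtain ⟨k, hk⟩ := IntermediateField.mem_bot.mp hb'
  have hkint : IsIntegral R k := by
    have := b.2
    rw [← hk] at this
    exact (isIntegral_algebraMap_iff (algebraMap K (AlgebraicClosure K)).injective).mp this
  obtain ⟨a, rfl⟩ := IsIntegrallyClosed.algebraMap_eq_of_integral hkint
  refine ⟨a, Subtype.ext ?_⟩
  rw [← hk, Subalgebra.coe_algebraMap, IsScalarTower.algebraMap_apply R K (AlgebraicClosure K)]

end AbsIntegersProfinite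

end Literature.NumberTheory.GaloisRepresentations

/-! ### Number-field layer: the discharges -/

namespace IsDedekindDomain.HeightOneSpectrum

open Literature.NumberTheory.GaloisRepresentations Field

variable {K : Type*} [Field K] [NumberField K] {v : HeightOneSpectrum (𝓞 K)}

/-- The residue ring `𝓞 K ⧸ (𝔓 ∩ 𝓞 K) = 𝓞 K ⧸ v` below a prime `𝔓 ∣ v` of `\bar ℤ_K` is
finite.  Ref: Neukirch, *Algebraic Number Theory*, Ch. I §6, (6.1) and §9. [folklore] -/
theorem finite_quotient_under_of_mem_primesAbove {𝔓 : Ideal (absIntegers (𝓞 K) K)}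
    (h𝔓 : 𝔓 ∈ v.primesAbove) : Finite (𝓞 K ⧸ 𝔓.under (𝓞 K)) := by
  rw [← h𝔓.2.over]
  exact v.asIdeal.finiteQuotientOfFreeOfNeBot v.ne_bot

/-- **Discharge of `exists_isArithFrobAt_of_mem_primesAbove`.**  For every prime `𝔓` of
`\bar ℤ_K` above the finite place `v` of the number field `K` there is `σ ∈ Gal(K̄/K)` with
`σ • x ≡ x ^ {N v} (mod 𝔓)` for all `x ∈ \bar ℤ_K`: apply
`Literature.NumberTheory.GaloisRepresentations.exists_isArithFrobAt_of_isInvariant_of_profinite` to the profinite group `Gal(K̄/K)`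
acting on the discrete ring `\bar ℤ_K` (`absIntegers.continuousSMul`, `absIntegers.isInvariant`).
Ref: Neukirch, *Algebraic Number Theory*, Ch. I §9, Prop. (9.4), Def. (9.5) and Exercise 2,
p. 58 (finite level); Serre, *Abelian ℓ-adic representations* (1968), Ch. I §2.1 (Frobenius
elements in `Gal(K̄/K)`). [cite: NeukirchANT1999, Ch. I §9 Prop. (9.4) and Exercise 2 (p. 58)]
[cite: SerreAbelianLadic1968, Ch. I §2.1] -/
theorem exists_isArithFrobAt_of_mem_primesAbove_holds :
    exists_isArithFrobAt_of_mem_primesAbove (K := K) (v := v) := by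
  intro 𝔓 h𝔓
  haveI := isMaximal_of_mem_primesAbove h𝔓
  haveI := finite_quotient_under_of_mem_primesAbove h𝔓
  letI : TopologicalSpace (absIntegers (𝓞 K) K) := ⊥
  haveI : DiscreteTopology (absIntegers (𝓞 K) K) := ⟨rfl⟩
  haveI := absIntegers.continuousSMul (𝓞 K) (K := K)
  haveI := absIntegers.isInvariant (𝓞 K) (K := K)
  exact exists_isArithFrobAt_of_isInvariant_of_profinite 𝔓

/-- **Discharge of `exists_smul_eq_of_mem_primesAbove`.**  `Gal(K̄/K)` acts transitively on
the primes of `\bar ℤ_K` above `v`: Mathlib's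
`Algebra.IsInvariant.exists_smul_of_under_eq_of_profinite` for the profinite group `Gal(K̄/K)`
acting on the discrete ring `\bar ℤ_K`.
Ref: Neukirch, *Algebraic Number Theory*, Ch. I §9, Prop. (9.1) (finite level; pass to the
limit); Serre, *Abelian ℓ-adic representations* (1968), Ch. I §2.1.
[cite: NeukirchANT1999, Ch. I §9 Prop. (9.1)] [cite: SerreAbelianLadic1968, Ch. I §2.1] -/
theorem exists_smul_eq_of_mem_primesAbove_holds :
    exists_smul_eq_of_mem_primesAbove (K := K) (v := v) := by
  intro 𝔓 𝔓' h𝔓 h𝔓'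
  haveI := h𝔓.1
  haveI := h𝔓'.1
  letI : TopologicalSpace (absIntegers (𝓞 K) K) := ⊥
  haveI : DiscreteTopology (absIntegers (𝓞 K) K) := ⟨rfl⟩
  haveI := absIntegers.continuousSMul (𝓞 K) (K := K)
  haveI := absIntegers.isInvariant (𝓞 K) (K := K)
  obtain ⟨σ, hσ⟩ := Algebra.IsInvariant.exists_smul_of_under_eq_of_profinite
    (A := 𝓞 K) (G := absoluteGaloisGroup K) 𝔓 𝔓' (h𝔓.2.over.symm.trans h𝔓'.2.over)
  exact ⟨σ, hσ.symm⟩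

/-- **Discharge of `exists_isArithFrobAt_conj_of_mem_primesAbove`.**  If `σ` is an arithmetic
Frobenius at `𝔓 ∣ v` and `𝔓' ∣ v`, then for some `τ` with `τ • 𝔓 = 𝔓'` the conjugate
`τ σ τ⁻¹` is an arithmetic Frobenius at `𝔓'` (transitivity,
`exists_smul_eq_of_mem_primesAbove_holds`, and Mathlib's `IsArithFrobAt.conj`; this is the
interim proof preserved in the parent file).
Ref: Neukirch, *Algebraic Number Theory*, Ch. I §9, Prop. (9.1) and Exercise 2 (p. 58); Serre,
*Abelian ℓ-adic representations* (1968), Ch. I §2.1.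
[cite: NeukirchANT1999, Ch. I §9 Prop. (9.1)] -/
theorem exists_isArithFrobAt_conj_of_mem_primesAbove_holds :
    exists_isArithFrobAt_conj_of_mem_primesAbove (K := K) (v := v) := by
  intro 𝔓 𝔓' h𝔓 h𝔓' σ hσ
  obtain ⟨τ, rfl⟩ := exists_smul_eq_of_mem_primesAbove_holds h𝔓 h𝔓'
  exact ⟨τ, rfl, hσ.conj τ⟩

end IsDedekindDomain.HeightOneSpectrum

/-! ### The comparison theorem `Ideal.decompositionSubgroup_eq_of_valuationSubring`

Setting of the parent file's section "Comparison with `ValuationSubring.decompositionSubgroup`":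
`R ⊆ K ⊆ L`, `S = integralClosure R L`, `A` a valuation subring of `L`, `𝔓 = 𝔪_A ∩ S`.  The
proof needs no import beyond the parent module. -/

namespace Ideal

/-- Localisations of a Dedekind domain at primes are valuation rings, in elementwise form: if `D`
is a Dedekind domain with fraction field `F` and `P` a prime of `D`, every `y ∈ F` satisfies
either `y * t = s` with `t ∉ P` (i.e. `y ∈ D_P`), or `y * s = t` with `s ∈ P`, `t ∉ P`
(i.e. `y ≠ 0` and `y⁻¹ ∈ P D_P`).
Ref: Serre, *Local Fields*, Ch. I §3, Prop. 4 (for a Noetherian domain `A`: Dedekind iff every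
`A_𝔭`, `𝔭 ≠ 0`, is a discrete valuation ring); in Mathlib
`IsLocalization.AtPrime.isDiscreteValuationRing_of_dedekind_domain` and `ValuationRing.cond`.
[cite: SerreLocalFields1979, Ch. I §3 Prop. 4] -/
theorem exists_mul_algebraMap_eq_or_of_isDedekindDomain {D F : Type*} [CommRing D]
    [IsDedekindDomain D] [Field F] [Algebra D F] [IsFractionRing D F] (P : Ideal D) [P.IsPrime]
    (y : F) :
    (∃ s t : D, t ∉ P ∧ y * algebraMap D F t = algebraMap D F s) ∨
      (∃ s t : D, s ∈ P ∧ t ∉ P ∧ y * algebraMap D F s = algebraMap D F t) := by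
  obtain ⟨a, b, hb, rfl⟩ := IsFractionRing.div_surjective (A := D) y
  have hb0 : b ≠ 0 := nonZeroDivisors.ne_zero hb
  have hbF : algebraMap D F b ≠ 0 := IsFractionRing.to_map_ne_zero_of_mem_nonZeroDivisors hb
  by_cases hP : P = ⊥
  · subst hP
    exact Or.inl ⟨a, b, by simpa using hb0, div_mul_cancel₀ _ hbF⟩
  haveI : IsDiscreteValuationRing (Localization.AtPrime P) :=
    IsLocalization.AtPrime.isDiscreteValuationRing_of_dedekind_domain D hP _
  have hinj : Function.Injective (algebraMap D (Localization.AtPrime P)) :=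
    IsLocalization.injective _ P.primeCompl_le_nonZeroDivisors
  obtain ⟨c, hc⟩ := ValuationRing.cond (algebraMap D (Localization.AtPrime P) a)
    (algebraMap D (Localization.AtPrime P) b)
  obtain ⟨⟨s, t⟩, rfl⟩ := IsLocalization.mk'_surjective P.primeCompl c
  rcases hc with hc | hc
  · -- `a * (s / t) = b`, i.e. `a * s = b * t`
    have hast : a * s = b * t := by
      apply hinj
      rw [IsLocalization.mul_mk'_eq_mk'_of_mul, IsLocalization.mk'_eq_iff_eq_mul] at hc
      simpa only [map_mul] using hc
    by_cases hs : s ∈ P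
    · refine Or.inr ⟨s, t, hs, t.2, ?_⟩
      rw [div_mul_eq_mul_div, div_eq_iff hbF, ← map_mul, ← map_mul, hast, mul_comm]
    · refine Or.inl ⟨t, s, hs, ?_⟩
      rw [div_mul_eq_mul_div, div_eq_iff hbF, ← map_mul, ← map_mul, hast, mul_comm]
  · -- `b * (s / t) = a`, i.e. `b * s = a * t`
    have hbst : b * s = a * t := by
      apply hinj
      rw [IsLocalization.mul_mk'_eq_mk'_of_mul, IsLocalization.mk'_eq_iff_eq_mul] at hc
      simpa only [map_mul] using hc
    refine Or.inl ⟨s, t, t.2, ?_⟩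
    rw [div_mul_eq_mul_div, div_eq_iff hbF, ← map_mul, ← map_mul, ← hbst, mul_comm]

section ValuationProof

variable (R : Type*) {K L : Type*} [CommRing R] [Field K] [Field L] [Algebra R K] [Algebra R L]
  [Algebra K L] [IsScalarTower R K L]

/-- If the ideal `𝔓` of `integralClosure R L` is the contraction of the non-units of a valuation
subring `A` of `L`, then `𝔓` is prime (the non-units of a valuation ring form its maximal ideal).
Ref: Serre, *Local Fields*, Ch. I §1 (a discrete valuation ring is local); Zariski–Samuel,
*Commutative Algebra* II, Ch. VI §7 (the centre `𝔐_{𝒫*} ∩ K*_𝒫` is a prime, indeed maximal,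
ideal). [folklore] -/
theorem isPrime_of_mem_iff_mem_nonunits (A : ValuationSubring L)
    (𝔓 : Ideal (integralClosure R L))
    (h𝔓 : ∀ x : integralClosure R L, x ∈ 𝔓 ↔ (x : L) ∈ A.nonunits) : 𝔓.IsPrime := by
  refine ⟨?_, ?_⟩
  · rw [Ne, Ideal.eq_top_iff_one, h𝔓, ValuationSubring.mem_nonunits_iff]
    simp
  · intro x y hxy
    rw [h𝔓, h𝔓, ValuationSubring.mem_nonunits_iff, ValuationSubring.mem_nonunits_iff]
    rw [h𝔓, ValuationSubring.mem_nonunits_iff, Subalgebra.coe_mul, map_mul] at hxy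
    by_contra h
    simp only [not_or, not_lt] at h
    exact absurd hxy (not_lt.mpr (one_le_mul h.1 h.2))

/-- **Key lemma (`A ⊆ S_𝔓`).**  Let `R` be a Dedekind domain with fraction field `K`, `L/K`
algebraic, `S = integralClosure R L`, `A` a valuation subring of `L` and `𝔓 ⊆ S` the
contraction of the non-units of `A`.  Then every `x ∈ A` can be written `x = s / t` with `s ∈ S`,
`t ∈ S ∖ 𝔓`, i.e. `x * t = s`.  Proof: reduce to the finite separable subextension
`K' = K(x ^ (q ^ n))` (`q` the exponential characteristic), whose ring of integers
`S' = integralClosure R K'` is Dedekind (Serre, Ch. I §4 Prop. 8–9; Mathlib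
`integralClosure.isDedekindDomain`) with `S'_{𝔓 ∩ S'}` a discrete valuation ring (Ch. I §3
Prop. 4, in the elementwise form `Ideal.exists_mul_algebraMap_eq_or_of_isDedekindDomain`); the
alternative `x ^ (q ^ n) * s = t`, `s ∈ 𝔓`, `t ∉ 𝔓` contradicts `x ∈ A`, and from
`x ^ (q ^ n) * t = s` we get `(x t) ^ (q ^ n) = s t ^ (q ^ n - 1) ∈ S`, so `x t ∈ S`.
This is the Dedekind case of Zariski–Samuel's theorem that a valuation ring of an algebraic
extension is the localisation of the integral closure at its centre.
Ref: Serre, *Local Fields*, Ch. I §3 Prop. 4 and §4 Prop. 8–9; Zariski–Samuel, *Commutative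
Algebra* II, Ch. VI §7, Thm. 12. [cite: SerreLocalFields1979, Ch. I §3 Prop. 4 and §4 Prop. 8–9]
[cite: ZariskiSamuel1960, Ch. VI §7 Thm. 12] -/
theorem exists_mul_eq_of_mem_valuationSubring [IsDedekindDomain R] [IsFractionRing R K]
    [Algebra.IsAlgebraic K L] (A : ValuationSubring L) (𝔓 : Ideal (integralClosure R L))
    (h𝔓 : ∀ x : integralClosure R L, x ∈ 𝔓 ↔ (x : L) ∈ A.nonunits) {x : L} (hx : x ∈ A) :
    ∃ s t : integralClosure R L, t ∉ 𝔓 ∧ x * t = s := by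
  haveI := isPrime_of_mem_iff_mem_nonunits R A 𝔓 h𝔓
  obtain ⟨q, hq⟩ := ExpChar.exists K
  have hint : IsIntegral K x := (Algebra.IsAlgebraic.isAlgebraic x).isIntegral
  -- a power `y = x ^ q ^ n` of `x` is separable over `K`
  obtain ⟨g, hg, n, hgn⟩ := (minpoly.irreducible hint).hasSeparableContraction q
  set N : ℕ := q ^ n with hN
  have hN0 : 0 < N := pow_pos (expChar_pos K q) n
  set y : L := x ^ N with hy
  have hysep : IsSeparable K y := hg.of_dvd <| minpoly.dvd K _ <| by
    simpa only [Polynomial.expand_aeval, minpoly.aeval] using congr_arg (Polynomial.aeval x) hgn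
  have hyA : y ∈ A := pow_mem hx N
  -- the finite separable subextension `K' = K(y)` and its ring of integers `S'`
  set K' : IntermediateField K L := IntermediateField.adjoin K {y} with hK'
  haveI : FiniteDimensional K K' := IntermediateField.adjoin.finiteDimensional hysep.isIntegral
  haveI : Algebra.IsSeparable K K' :=
    (IntermediateField.isSeparable_adjoin_simple_iff_isSeparable (F := K) (E := L)).2 hysep
  haveI : IsDedekindDomain (integralClosure R K') := integralClosure.isDedekindDomain R K K'
  haveI : IsFractionRing (integralClosure R K') K' :=
    integralClosure.isFractionRing_of_finite_extension K K'
  -- the inclusion `S' → S` and the prime `P = 𝔓 ∩ S'`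
  set f : K' →ₐ[R] L := K'.val.restrictScalars R with hf
  set g' : integralClosure R K' →ₐ[R] integralClosure R L := f.mapIntegralClosure with hg'
  have hg'coe : ∀ z : integralClosure R K', ((g' z : integralClosure R L) : L) = (z : K') :=
    fun z => rfl
  set P : Ideal (integralClosure R K') := 𝔓.comap g' with hP
  have y_mem : y ∈ K' := IntermediateField.mem_adjoin_simple_self K y
  rcases exists_mul_algebraMap_eq_or_of_isDedekindDomain P (⟨y, y_mem⟩ : K') with
    ⟨s, t, ht, hst⟩ | ⟨s, t, hs, ht, hst⟩
  · -- `y * t = s` with `t ∉ 𝔓`; then `(x * t) ^ N = s * t ^ (N - 1)` is integral over `R`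
    have hst' : y * ((g' t : integralClosure R L) : L) = ((g' s : integralClosure R L) : L) := by
      rw [hg'coe, hg'coe]
      exact congr_arg ((↑) : K' → L) hst
    have hxt : IsIntegral R (x * ((g' t : integralClosure R L) : L)) := by
      refine IsIntegral.of_pow hN0 ?_
      have : (x * ((g' t : integralClosure R L) : L)) ^ N =
          ((g' s : integralClosure R L) : L) * ((g' t : integralClosure R L) : L) ^ (N - 1) := by
        rw [mul_pow, ← hst', hy, mul_assoc, ← pow_succ', Nat.sub_add_cancel hN0]
      rw [this]
      exact ((g' s).2.mul ((g' t).2.pow _))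
    refine ⟨⟨_, hxt⟩, g' t, ?_, rfl⟩
    rwa [hP, Ideal.mem_comap] at ht
  · -- `y * s = t` with `s ∈ 𝔓`, `t ∉ 𝔓`: impossible since `y ∈ A`
    exfalso
    rw [hP, Ideal.mem_comap, h𝔓, ValuationSubring.mem_nonunits_iff] at hs ht
    apply ht
    have hst' : y * ((g' s : integralClosure R L) : L) = ((g' t : integralClosure R L) : L) := by
      rw [hg'coe, hg'coe]
      exact congr_arg ((↑) : K' → L) hst
    rw [← hst', map_mul]
    calc A.valuation y * A.valuation ((g' s : integralClosure R L) : L)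
        ≤ 1 * A.valuation ((g' s : integralClosure R L) : L) :=
          mul_le_mul' ((A.valuation_le_one_iff y).2 hyA) le_rfl
      _ < 1 := by rwa [one_mul]

/-- **Discharge of `Ideal.decompositionSubgroup_eq_of_valuationSubring`.**  For `R` Dedekind
with fraction field `K`, `L/K` algebraic, `S = integralClosure R L ⊆ A` a valuation subring of `L`
and `𝔓 = 𝔪_A ∩ S`, the stabiliser of `𝔓` in `L ≃ₐ[K] L` equals the stabiliser of `A`
(Mathlib's `ValuationSubring.decompositionSubgroup K A`).  `≥` is the parent file's
`Ideal.decompositionSubgroup_valuationSubring_le`; for `≤`, if `σ • 𝔓 = 𝔓` and `x = s / t ∈ A`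
(`Ideal.exists_mul_eq_of_mem_valuationSubring`), then `σ x = σ s / σ t` with `σ s ∈ S ⊆ A` and
`σ t ∈ S ∖ 𝔓 ⊆ Aˣ`, so `σ • A ≤ A`, and equality follows by applying this to `σ⁻¹`.
Ref: Serre, *Local Fields*, Ch. I §7 (definition of `D_𝔓` after Prop. 19), Prop. 19–21, and
Ch. II §3, Cor. 4 to Thm. 1 (the decomposition group of the valuation `w_i`); Ch. I §3 Prop. 4.
[cite: SerreLocalFields1979, Ch. I §7 Prop. 19–21 and Ch. II §3 Cor. 4] -/
theorem decompositionSubgroup_eq_of_valuationSubring_holds :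
    decompositionSubgroup_eq_of_valuationSubring R (K := K) (L := L) := by
  intro _ _ _ A hA 𝔓 h𝔓
  refine le_antisymm ?_ (decompositionSubgroup_valuationSubring_le R A 𝔓 h𝔓)
  have key : ∀ σ : L ≃ₐ[K] L, σ • 𝔓 = 𝔓 → σ • A ≤ A := by
    rintro σ hσ _ ⟨x, hx, rfl⟩
    obtain ⟨s, t, ht, hxt⟩ := exists_mul_eq_of_mem_valuationSubring R (K := K) A 𝔓 h𝔓 hx
    have hσt : σ • t ∉ 𝔓 := by rwa [← hσ, Ideal.smul_mem_pointwise_smul_iff]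
    simp only [h𝔓, ValuationSubring.mem_nonunits_iff_or, not_or, not_not] at ht hσt
    have ht0 : (t : L) ≠ 0 := ht.1
    have hx' : x = (s : L) * (t : L)⁻¹ := by rw [← hxt, mul_inv_cancel_right₀ ht0]
    change σ x ∈ A
    rw [hx', map_mul, map_inv₀]
    refine A.mul_mem _ _ ?_ ?_
    · simpa only [integralClosure.coe_smul, AlgEquiv.smul_def] using hA (σ • s)
    · simpa only [integralClosure.coe_smul, AlgEquiv.smul_def] using hσt.2
  intro σ hσ
  rw [mem_decompositionSubgroup_iff] at hσ
  refine le_antisymm (key σ hσ) ?_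
  rw [ValuationSubring.subset_pointwise_smul_iff]
  exact key σ⁻¹ (by rw [← hσ, inv_smul_smul, hσ])

end ValuationProof

end Ideal
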